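import Literature.AlgebraicGeometry.Resolution.CompositeValuations
import Mathlib.RingTheory.DiscreteValuationRing.Basic
import Mathlib.RingTheory.Valuation.ValuationSubring
import Mathlib.RingTheory.Localization.AtPrime.Basic
import Mathlib.RingTheory.LocalRing.ResidueField.Basic
import HarnessLib

/-!
# The composite valuation ring of a DVR pair (Zariski–Samuel, composite valuations)

Line `birth` of crux `SharpStrata.SepExcModels` (stmt-ResolutionOfSingularities-16828,
`Cruxes/SepExcModels/Lines/birth.lean`), lead c1: the CONSTRUCTION half of tool stub (T3, ring
form) `stub_ratAbhyankarPlace_of_dvrPair` (assembled in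
`Theorems/SharpStrataSepExcModelsDvrPairValuation.lean`).

Setting: `R` a (local) ring, `P` a prime of `R` with `W = R_P` a discrete valuation ring
(`[IsLocalization.AtPrime W P]`) realised inside a field `K = Frac W`
(`[Algebra W K] [IsFractionRing W K]`, and `[Algebra R K] [IsScalarTower R W K]` when `R` is
compared with `K`), and `R ⧸ P` a discrete valuation ring — a DVR FLAG of length two.

## Content (all folklore: Zariski–Samuel II, Ch. VI § 10; Bourbaki, *Alg. Comm.* VI § 4)

No new definitions are introduced: the two valuation subrings of `K` in play are produced by
existence statements with a membership characterisation, and the lemmas take that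
characterisation as a hypothesis.

* `residue_mem_or_inv_mem` — the image `V̄` of `R` (i.e. of `R ⧸ P`) in the residue field
  `κ(W) = Frac (R ⧸ P)` is a valuation ring of `κ(W)`: for every `z`, `z` or `z⁻¹` lies in `V̄`.
* `exists_compVal` — the COMPOSITE valuation ring `O = {x ∈ W | x̄ ∈ V̄}` of `K` exists
  (membership: `x = w` for some `w ∈ W` with `w̄ ∈ V̄`); `exists_locVal` — `W` itself as a
  valuation subring of `K`; `le_of_mem_iff : O ≤ W`.
* `algebraMap_mem_of_mem_iff`, `dominates_of_mem_iff`, `residuallyRational_of_mem_iff` — `R ⊆ O`,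
  `𝔪_R ⊆ 𝔪_O` (for `R` local), and every element of `O` is congruent to an element of `R`
  modulo `𝔪_O` ("residually rational").
* `exists_mem_ne_zero`, `exists_lift_nonunit` — `P ≠ 0` (as `W` is not a field) and a lift
  `t ∈ R ∖ P` of a non-zero non-unit of `R ⧸ P` (which is not a field).
* `valuation_zpow_mul_zpow_eq_one` — for `π ∈ P ∖ 0` and such a `t`, `v_O(π ^ a * t ^ b) = 1`
  (`a, b ∈ ℤ`) forces `a = b = 0`: the values of `π, t` are `ℤ`-independent (first in `W`, where
  `t` is a unit and `π` is not, then in `O`, where `t` is not a unit).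
* `exists_composite_valuationSubring` — the package consumed by the assembly: a valuation ring
  `O` of `K` containing `R`, dominating it, residually rational over it, with two elements of
  `R` whose values are `ℤ`-independent.

## Sources

* O. Zariski, P. Samuel, *Commutative Algebra* II, Ch. VI § 10 (composite valuations);
  N. Bourbaki, *Algèbre commutative*, Ch. VI § 4. [folklore]
-/

noncomputable section

-- single-problem summit: the doubled namespace component `ResolutionOfSingularities` is forced
set_option linter.dupNamespace false

open Literature.AlgebraicGeometry.Resolution IsLocalRing

namespace Summit.ResolutionOfSingularities.ResolutionOfSingularities.Theorems.SepExcModels.DvrPairValuationComposite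

/-! ## Generalities -/

section Generalities

/-- In a linearly ordered commutative group with zero, an element `a < 1` has no non-trivial
integer power equal to `1`. [folklore] -/
theorem eq_zero_of_zpow_eq_one {Γ : Type*} [LinearOrderedCommGroupWithZero Γ] {a : Γ}
    (ha : a < 1) {m : ℤ} (h : a ^ m = 1) : m = 0 := by
  obtain ⟨n, rfl | rfl⟩ := Int.eq_nat_or_neg m
  · rw [zpow_natCast] at h
    by_contra hn
    exact (pow_lt_one₀ zero_le ha (by exact_mod_cast hn)).ne h
  · rw [zpow_neg, zpow_natCast, inv_eq_one] at h
    by_contra hn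
    have hn' : n ≠ 0 := by
      rintro rfl
      simp at hn
    exact (pow_lt_one₀ zero_le ha hn').ne h

end Generalities

/-! ## The setting: `W = R_P` a DVR -/

section Setting

variable (K : Type*) [Field K] {R : Type*} [CommRing R] (P : Ideal R) [P.IsPrime]
  (W : Type*) [CommRing W] [IsDomain W] [IsDiscreteValuationRing W] [Algebra R W]
  [IsLocalization.AtPrime W P]

/-- The kernel of `R → W → κ(W)` is `P`. [folklore] -/
theorem residue_algebraMap_eq_zero_iff (r : R) :
    residue W (algebraMap R W r) = 0 ↔ r ∈ P := by
  rw [residue_eq_zero_iff]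
  exact IsLocalization.AtPrime.to_map_mem_maximal_iff W P r

/-- Two elements of `R` have the same image in `κ(W)` iff they agree modulo `P`. [folklore] -/
theorem residue_algebraMap_eq_iff (a b : R) :
    residue W (algebraMap R W a) = residue W (algebraMap R W b) ↔
      Ideal.Quotient.mk P a = Ideal.Quotient.mk P b := by
  rw [Ideal.Quotient.eq, ← sub_eq_zero, ← map_sub, ← map_sub, residue_algebraMap_eq_zero_iff P W]

include W in
/-- `P ≠ 0`: a non-zero element `π ∈ P` (the discrete valuation ring `W = R_P` is not a field).
[folklore] -/
theorem exists_mem_ne_zero : ∃ π ∈ P, π ≠ 0 := by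
  obtain ⟨m, hm, hm0⟩ :=
    Submodule.exists_mem_ne_zero_of_ne_bot (IsDiscreteValuationRing.not_a_field W)
  obtain ⟨a, s, rfl⟩ := IsLocalization.exists_mk'_eq P.primeCompl m
  refine ⟨a, (IsLocalization.AtPrime.mk'_mem_maximal_iff W P a s).mp hm, ?_⟩
  rintro rfl
  exact hm0 (IsLocalization.mk'_zero s)

/-- A lift of a non-unit of a quotient `R ⧸ I` is a non-unit of the local ring `R`. [folklore] -/
theorem mem_maximalIdeal_of_not_isUnit_mk [IsLocalRing R] {I : Ideal R} {t : R}
    (ht : ¬IsUnit (Ideal.Quotient.mk I t)) : t ∈ maximalIdeal R :=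
  (mem_maximalIdeal t).mpr fun h => ht (h.map _)

/-! ## The valuation ring `V̄ ⊆ κ(W)` when `R ⧸ P` is a DVR -/

variable [IsDiscreteValuationRing (R ⧸ P)]

/-- A lift `t ∈ R ∖ P` of a non-zero non-unit of the discrete valuation ring `R ⧸ P` (which is
not a field). [folklore] -/
theorem exists_lift_nonunit : ∃ t : R, t ∉ P ∧ ¬IsUnit (Ideal.Quotient.mk P t) := by
  obtain ⟨q, hq, hq0⟩ :=
    Submodule.exists_mem_ne_zero_of_ne_bot (IsDiscreteValuationRing.not_a_field (R ⧸ P))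
  obtain ⟨t, rfl⟩ := Ideal.Quotient.mk_surjective q
  exact ⟨t, fun ht => hq0 (Ideal.Quotient.eq_zero_iff_mem.mpr ht), (mem_maximalIdeal _).mp hq⟩

include P in
/-- **The image `V̄` of `R` in `κ(W)` is a valuation ring of `κ(W)`**: every element `z` of the
residue field `κ(W) = Frac (R ⧸ P)` of `W = R_P`, or its inverse, is the image of an element of
`R`. Indeed `z = ā / s̄` with `s ∉ P`, and in the valuation ring `R ⧸ P` one of `ā`, `s̄` divides
the other. [folklore] -/
theorem residue_mem_or_inv_mem (z : ResidueField W) :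
    (∃ r : R, residue W (algebraMap R W r) = z) ∨
      ∃ r : R, residue W (algebraMap R W r) = z⁻¹ := by
  obtain ⟨w, rfl⟩ := residue_surjective z
  obtain ⟨a, s, rfl⟩ := IsLocalization.exists_mk'_eq P.primeCompl w
  have hs0 : residue W (algebraMap R W s) ≠ 0 := fun h =>
    s.2 ((residue_algebraMap_eq_zero_iff P W s).mp h)
  have hz : residue W (IsLocalization.mk' W a s) =
      residue W (algebraMap R W a) / residue W (algebraMap R W s) := by
    rw [eq_div_iff hs0, ← map_mul, IsLocalization.mk'_spec]
  obtain ⟨c, hc⟩ := ValuationRing.cond (Ideal.Quotient.mk P a) (Ideal.Quotient.mk P s)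
  obtain ⟨c, rfl⟩ := Ideal.Quotient.mk_surjective c
  rw [← map_mul, ← map_mul] at hc
  rcases hc with hc | hc
  · have h1 : residue W (algebraMap R W a) * residue W (algebraMap R W c) =
        residue W (algebraMap R W s) := by
      rw [← map_mul, ← map_mul]
      exact (residue_algebraMap_eq_iff P W _ _).mpr hc
    have ha0 : residue W (algebraMap R W a) ≠ 0 := fun h => hs0 (by rw [← h1, h, zero_mul])
    refine Or.inr ⟨c, ?_⟩
    rw [hz, inv_div, eq_div_iff ha0, mul_comm]
    exact h1
  · have h1 : residue W (algebraMap R W s) * residue W (algebraMap R W c) =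
        residue W (algebraMap R W a) := by
      rw [← map_mul, ← map_mul]
      exact (residue_algebraMap_eq_iff P W _ _).mpr hc
    refine Or.inl ⟨c, ?_⟩
    rw [hz, eq_div_iff hs0, mul_comm]
    exact h1

/-! ## The composite valuation ring `O ⊆ W ⊆ K` -/

variable [Algebra W K] [IsFractionRing W K]

include P in
/-- **The composite valuation ring** `O = {x ∈ W | x̄ ∈ V̄}` of `K = Frac W` exists: the preimage
of the valuation ring `V̄ ⊆ κ(W)` (the image of `R`) under the place of `W`. It is a valuation
subring: for `x ∈ K` either `x` or `x⁻¹` lies in `W`; a non-unit of `W` has residue `0 ∈ V̄`, and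
for a unit `u` of `W` one of `ū`, `ū⁻¹` lies in `V̄`. [folklore] -/
theorem exists_compVal : ∃ O : ValuationSubring K, ∀ x : K, x ∈ O ↔
    ∃ w : W, (∃ r : R, residue W (algebraMap R W r) = residue W w) ∧ algebraMap W K w = x := by
  let S : Subring (ResidueField W) := ((residue W).comp (algebraMap R W)).range
  let T : Subring K := (S.comap (residue W)).map (algebraMap W K)
  have key : ∀ w : W, algebraMap W K w ∈ T ∨ (algebraMap W K w)⁻¹ ∈ T := by
    intro w
    by_cases hw : IsUnit w
    · obtain ⟨u, rfl⟩ := hw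
      rcases residue_mem_or_inv_mem P W (residue W u) with ⟨r, hr⟩ | ⟨r, hr⟩
      · exact Or.inl ⟨u, ⟨r, hr⟩, rfl⟩
      · refine Or.inr ⟨↑u⁻¹, ⟨r, ?_⟩, by rw [map_units_inv]⟩
        show residue W (algebraMap R W r) = residue W ↑u⁻¹
        rw [map_units_inv]
        exact hr
    · refine Or.inl ⟨w, ⟨0, ?_⟩, rfl⟩
      show residue W (algebraMap R W 0) = residue W w
      rw [map_zero, map_zero, (residue_eq_zero_iff w).mpr ((mem_maximalIdeal w).mpr hw)]
  refine ⟨{ toSubring := T, mem_or_inv_mem' := fun x => ?_ }, fun x => Subring.mem_map⟩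
  rcases ValuationRing.isInteger_or_isInteger W x with ⟨w, hw⟩ | ⟨w, hw⟩
  · rw [← hw]
    exact key w
  · have hx : x = (algebraMap W K w)⁻¹ := by rw [hw, inv_inv]
    rw [hx, inv_inv]
    exact (key w).symm

/-- **`W` as a valuation subring of `K = Frac W`** exists. [folklore] -/
theorem exists_locVal :
    ∃ Wv : ValuationSubring K, ∀ x : K, x ∈ Wv ↔ ∃ w : W, algebraMap W K w = x :=
  ⟨{ toSubring := (algebraMap W K).range
     mem_or_inv_mem' := fun x => by
       rcases ValuationRing.isInteger_or_isInteger W x with ⟨w, hw⟩ | ⟨w, hw⟩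
       exacts [Or.inl ⟨w, hw⟩, Or.inr ⟨w, hw⟩] }, fun _ => Iff.rfl⟩

variable {K P W}
variable {O Wv : ValuationSubring K}
  (hO : ∀ x : K, x ∈ O ↔
    ∃ w : W, (∃ r : R, residue W (algebraMap R W r) = residue W w) ∧ algebraMap W K w = x)
  (hWv : ∀ x : K, x ∈ Wv ↔ ∃ w : W, algebraMap W K w = x)

include hO hWv in
omit [IsFractionRing W K] in
/-- `O ≤ W`. [folklore] -/
theorem le_of_mem_iff : O ≤ Wv := by
  intro x hx
  obtain ⟨w, -, rfl⟩ := (hO x).mp hx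
  exact (hWv _).mpr ⟨w, rfl⟩

include hO in
/-- An element `w ∈ W` admitting no inverse `w'` in `W` with `w̄' ∈ V̄` is a non-unit of `O`:
`v_O(w) < 1`. [folklore] -/
theorem valuation_lt_one_of_mem_iff (w : W)
    (hw : ∀ w' : W, (∃ r : R, residue W (algebraMap R W r) = residue W w') → w * w' ≠ 1) :
    O.valuation (algebraMap W K w) < 1 := by
  rw [← ValuationSubring.mem_nonunits_iff, ValuationSubring.mem_nonunits_iff_or]
  by_cases h0 : algebraMap W K w = 0
  · exact Or.inl h0
  refine Or.inr fun hinv => ?_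
  obtain ⟨w', hw', he⟩ := (hO _).mp hinv
  refine hw w' hw' (IsFractionRing.injective W K ?_)
  rw [map_mul, he, map_one, mul_inv_cancel₀ h0]

include hWv in
omit [IsDomain W] [IsDiscreteValuationRing W] in
/-- A non-unit of `W` is a non-unit of the valuation subring `W ⊆ K`. [folklore] -/
theorem locVal_valuation_lt_one (w : W) (hw : ¬IsUnit w) :
    Wv.valuation (algebraMap W K w) < 1 := by
  rw [← ValuationSubring.mem_nonunits_iff, ValuationSubring.mem_nonunits_iff_or]
  by_cases h0 : algebraMap W K w = 0
  · exact Or.inl h0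
  refine Or.inr fun hinv => hw ?_
  obtain ⟨w', he⟩ := (hWv _).mp hinv
  refine IsUnit.of_mul_eq_one w' (IsFractionRing.injective W K ?_)
  rw [map_mul, he, map_one, mul_inv_cancel₀ h0]

include hWv in
omit [IsDiscreteValuationRing W] in
/-- A unit of `W` has value `1` in the valuation subring `W ⊆ K`. [folklore] -/
theorem locVal_valuation_eq_one (w : W) (hw : IsUnit w) :
    Wv.valuation (algebraMap W K w) = 1 := by
  obtain ⟨u, rfl⟩ := hw
  have hu : algebraMap W K u ∈ Wv := (hWv _).mpr ⟨u, rfl⟩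
  have hui : (algebraMap W K u)⁻¹ ∈ Wv := (hWv _).mpr ⟨↑u⁻¹, by rw [map_units_inv]⟩
  exact (Wv.valuation_eq_one_iff ⟨_, hu⟩).mp (isUnit_of_inv_mem Wv hu hui
    ((map_ne_zero_iff _ (IsFractionRing.injective W K)).mpr u.ne_zero))

/-! ## `O` over `R`: containment, residual rationality, domination, independence of values -/

variable [Algebra R K] [IsScalarTower R W K]

include hO in
omit [IsFractionRing W K] in
/-- `R ⊆ O`. [folklore] -/
theorem algebraMap_mem_of_mem_iff (r : R) : algebraMap R K r ∈ O :=
  (hO _).mpr ⟨algebraMap R W r, ⟨r, rfl⟩, (IsScalarTower.algebraMap_apply R W K r).symm⟩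

include hO in
/-- **Residual rationality**: every element of `O` is congruent modulo `𝔪_O` to an element of
`R` (its residue in `V̄` is the image of some `r ∈ R`, and `𝔪_W ⊆ 𝔪_O`). [folklore] -/
theorem residuallyRational_of_mem_iff {x : K} (hx : x ∈ O) :
    ∃ r : R, O.valuation (algebraMap R K r - x) < 1 := by
  obtain ⟨w, ⟨r, hr⟩, rfl⟩ := (hO _).mp hx
  refine ⟨r, ?_⟩
  rw [IsScalarTower.algebraMap_apply R W K, ← map_sub]
  refine valuation_lt_one_of_mem_iff hO _ fun w' _ h1 => ?_
  have : residue W ((algebraMap R W r - w) * w') = 0 := by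
    rw [map_mul, map_sub, hr, sub_self, zero_mul]
  rw [h1, map_one] at this
  exact one_ne_zero this

include P hO in
omit [IsDiscreteValuationRing (R ⧸ P)] in
/-- **Domination** (for `R` local): `𝔪_R ⊆ 𝔪_O`, i.e. `v_O(r) < 1` for `r ∈ 𝔪_R`. (If `r w' = 1`
in `W` with `w̄' = r̄'`, `r' ∈ R`, then `r r' - 1 ∈ P ⊆ 𝔪_R`, so `1 ∈ 𝔪_R`.) [folklore] -/
theorem dominates_of_mem_iff [IsLocalRing R] {r : R} (hr : r ∈ maximalIdeal R) :
    O.valuation (algebraMap R K r) < 1 := by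
  rw [IsScalarTower.algebraMap_apply R W K]
  refine valuation_lt_one_of_mem_iff hO (algebraMap R W r) fun w' hw' h1 => ?_
  obtain ⟨r', hr'⟩ := hw'
  have h2 : Ideal.Quotient.mk P (r * r') = Ideal.Quotient.mk P 1 := by
    rw [← residue_algebraMap_eq_iff P W, map_mul, map_mul, hr', ← map_mul, h1]
    simp only [map_one]
  rw [Ideal.Quotient.eq] at h2
  have h3 : r * r' - 1 ∈ maximalIdeal R := IsLocalRing.le_maximalIdeal ‹P.IsPrime›.ne_top h2
  have h4 : (1 : R) ∈ maximalIdeal R := by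
    have := (maximalIdeal R).sub_mem (Ideal.mul_mem_right r' _ hr) h3
    rwa [sub_sub_cancel] at this
  exact (Ideal.ne_top_iff_one _).mp (maximalIdeal.isMaximal R).ne_top h4

include hO in
omit [IsDiscreteValuationRing (R ⧸ P)] in
/-- **`ℤ`-independence of the values of `π` and `t`** (for `R` local with fraction field `K`).
For `π ∈ P ∖ 0` and `t ∈ R ∖ P` with `t̄` a non-unit of `R ⧸ P`: if `v_O(π ^ a * t ^ b) = 1`
(`a, b ∈ ℤ`) then `a = b = 0`. Indeed `π ^ a t ^ b` is then a unit of `O`, hence of `W`, where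
`t` is a unit and `π` is not, so `a = 0`; then `t ^ b` is a unit of `O`, where `t` is not, so
`b = 0`. [folklore] -/
theorem valuation_zpow_mul_zpow_eq_one [IsLocalRing R] [IsFractionRing R K] {π t : R}
    (hπP : π ∈ P) (hπ0 : π ≠ 0) (htP : t ∉ P) (htu : ¬IsUnit (Ideal.Quotient.mk P t)) {a b : ℤ}
    (h : O.valuation (algebraMap R K π ^ a * algebraMap R K t ^ b) = 1) :
    a = 0 ∧ b = 0 := by
  obtain ⟨Wv, hWv⟩ := exists_locVal K W
  have hπK : algebraMap R K π ≠ 0 := (map_ne_zero_iff _ (IsFractionRing.injective R K)).mpr hπ0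
  have htK : algebraMap R K t ≠ 0 :=
    (map_ne_zero_iff _ (IsFractionRing.injective R K)).mpr fun h => htP (h ▸ P.zero_mem)
  have hu0 : algebraMap R K π ^ a * algebraMap R K t ^ b ≠ 0 :=
    mul_ne_zero (zpow_ne_zero _ hπK) (zpow_ne_zero _ htK)
  have huO : algebraMap R K π ^ a * algebraMap R K t ^ b ∈ O :=
    (O.valuation_le_one_iff _).mp h.le
  have huiO : (algebraMap R K π ^ a * algebraMap R K t ^ b)⁻¹ ∈ O := by
    rw [← O.valuation_le_one_iff, map_inv₀, h, inv_one]
  have hW : Wv.valuation (algebraMap R K π ^ a * algebraMap R K t ^ b) = 1 :=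
    (Wv.valuation_eq_one_iff ⟨_, le_of_mem_iff hO hWv huO⟩).mp
      (isUnit_of_inv_mem _ (le_of_mem_iff hO hWv huO) (le_of_mem_iff hO hWv huiO) hu0)
  have htW : Wv.valuation (algebraMap R K t) = 1 := by
    rw [IsScalarTower.algebraMap_apply R W K]
    exact locVal_valuation_eq_one hWv _
      ((IsLocalization.AtPrime.isUnit_to_map_iff W P t).mpr htP)
  have hπW : Wv.valuation (algebraMap R K π) < 1 := by
    rw [IsScalarTower.algebraMap_apply R W K]
    exact locVal_valuation_lt_one hWv _ fun hu =>
      (IsLocalization.AtPrime.isUnit_to_map_iff W P π).mp hu hπP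
  rw [map_mul, map_zpow₀, map_zpow₀, htW, one_zpow, mul_one] at hW
  have ha : a = 0 := eq_zero_of_zpow_eq_one hπW hW
  subst ha
  rw [zpow_zero, one_mul, map_zpow₀] at h
  exact ⟨rfl, eq_zero_of_zpow_eq_one
    (dominates_of_mem_iff (P := P) hO (mem_maximalIdeal_of_not_isUnit_mk htu)) h⟩

end Setting

/-! ## The package consumed by the assembly -/

/-- **The composite valuation ring of a DVR pair** (package for the assembly). For `R` local with
fraction field `K`, `P` a prime with `W = R_P` a DVR (realised in `K`) and `R ⧸ P` a DVR, there is
a valuation ring `O` of `K` — the composite `{x ∈ W | x̄ ∈ R ⧸ P}` — containing `R`, dominating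
it, residually rational over it, together with `π, t ∈ R`, non-zero in `K`, whose values are
`ℤ`-independent: `v_O(π ^ a * t ^ b) = 1 ⇒ a = b = 0`. [folklore] -/
theorem exists_composite_valuationSubring (K : Type) [Field K] {R : Type} [CommRing R]
    [IsLocalRing R] [Algebra R K] [IsFractionRing R K] (P : Ideal R) [P.IsPrime]
    [IsDiscreteValuationRing (R ⧸ P)] (W : Type) [CommRing W] [IsDomain W]
    [IsDiscreteValuationRing W] [Algebra R W] [IsLocalization.AtPrime W P] [Algebra W K]
    [IsScalarTower R W K] [IsFractionRing W K] :
    ∃ O : ValuationSubring K, (∀ r : R, algebraMap R K r ∈ O) ∧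
      (∀ r ∈ IsLocalRing.maximalIdeal R, O.valuation (algebraMap R K r) < 1) ∧
      (∀ x ∈ O, ∃ r : R, O.valuation (algebraMap R K r - x) < 1) ∧
      ∃ π t : R, algebraMap R K π ≠ 0 ∧ algebraMap R K t ≠ 0 ∧
        ∀ a b : ℤ, O.valuation (algebraMap R K π ^ a * algebraMap R K t ^ b) = 1 →
          a = 0 ∧ b = 0 := by
  obtain ⟨O, hO⟩ := exists_compVal K P W
  obtain ⟨t, htP, htu⟩ := exists_lift_nonunit P
  obtain ⟨π, hπP, hπ0⟩ := exists_mem_ne_zero P W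
  exact ⟨O, algebraMap_mem_of_mem_iff hO, fun r hr => dominates_of_mem_iff (P := P) hO hr,
    fun x hx => residuallyRational_of_mem_iff hO hx, π, t,
    (map_ne_zero_iff _ (IsFractionRing.injective R K)).mpr hπ0,
    (map_ne_zero_iff _ (IsFractionRing.injective R K)).mpr fun h => htP (h ▸ P.zero_mem),
    fun a b h => valuation_zpow_mul_zpow_eq_one hO hπP hπ0 htP htu h⟩

end Summit.ResolutionOfSingularities.ResolutionOfSingularities.Theorems.SepExcModels.DvrPairValuationComposite

end
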